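import Literature.Computability.Cryptography.LWESwitchKernelProg
import HarnessLib

/-!
# The h₃ machine's modulus-switch kernel on a BLOCK of samples, and its reference blocks, as typed polynomial-time programs

Topic `Computability/Cryptography` (LWE), grouping namespace `BLPRS2013.KProg`; sequel of `LWESwitchKernelProg.lean` (`kernelFlat` /
`kernelOf`: ONE switched sample as a program, `kernelOf_codeFP`). A row of the rate-guess test (Cor. 3.2 with Lemma 2.15) first draws
the secret shift `t ← U(ℤ_qⁿ)` — by the machine: `n` residues mod `q` of `L`-bit coin blocks — and then switches each of the `m` samples
of the block with its own slice of coins; the test also needs self-generated "uniform" reference blocks — by the machine: residues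
of coin blocks again. This file writes both as deterministic functions of the inputs and a flat coin string, in closed form and as
programs against a record, and proves the programs typed polynomial time (everything PROVED, definitions with bodies, no named
fact; the laws on uniform coins are the business of the sequel `LWESwitchRowProgLaw.lean`):

* `tFlat q L n coins` (the shift: residues of the first `n` blocks of `L` bits), `rowFlat …` (shift, then `kernelFlat` on sample `i`
  with the `i`-th chunk of width `C₁ = nC + P + coinLen` of the remaining coins), `refFlat q L n m coins` (`m` reference samples, each
  `n + 1` residues);
* the records `RRec = KRec × (L, n)` / `rRecOf`, `FRec = (q, L, n, m)`; the programs `tOf`, `rowOf`, `refOf` with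
  `rowOf_rRecOf`, `refOf_eq` (equal to the closed forms at the genuine records) and **`rowOf_codeFP`**, **`refOf_codeFP`**.

## References

* Z. Brakerski, A. Langlois, C. Peikert, O. Regev, D. Stehlé, *Classical hardness of learning with errors*, STOC 2013;
  arXiv:1306.0281, Cor. 3.2 with Lemma 2.15 and §5. [BrakerskiEtAl2013]
* O. Regev, *On lattices, learning with errors …*, J. ACM 56 (2009), Lemma 4.1 (proof: the uniform shift `t`). [RegevLWE2009]
* S. Arora, B. Barak, *Computational Complexity: A Modern Approach*, CUP 2009, §1.3, Def. 7.1. [AroraBarak2009]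
-/

noncomputable section

namespace Literature.Computability.Cryptography

namespace BLPRS2013

namespace KProg

open Literature.Computability.Complexity Literature.Computability.Complexity.CodeFP
  Literature.Computability.QuantumComplexity Literature.Probability.Distributions GaussRejMachine GaussRejFP
open Literature.Algebra.EuclideanLattices (encodeRat encodeRat_injective)

/-! ### Closed forms -/

/-- **The secret shift from coins**: `tⱼ = (value of the j-th block of L bits) mod q`, `j < n`. [cite: RegevLWE2009, Lemma 4.1 (proof)] -/
def tFlat (q L n : ℕ) (coins : List Bool) : List ℕ :=
  (List.range n).map fun j => bitsToNat ((coins.drop (j * L)).take L) % q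

/-- The coins ONE switched sample consumes: `C₁ = nC + P + coinLen`, `C = R(w+1+P_r)`. [folklore] -/
def sampleWidth (n Pr w R P : ℕ) (PG : PGParams) : ℕ := n * (R * (w + 1 + Pr)) + (P + PG.coinLen)

/-- **A block of switched samples as a function of `(S, coins)`**: the shift from the first `nL` coins, then sample `i` by
`kernelFlat` on the `i`-th chunk of width `C₁` of the rest. [cite: BrakerskiEtAl2013, Cor. 3.2 with Lemma 2.15; RegevLWE2009, Lemma 4.1 (proof)] -/
def rowFlat (θ : ℚ) (s N Pr w R q Q : ℕ) (κh : ℚ) (b P : ℕ) (PG : PGParams) (L n : ℕ) (S : List (List ℕ × ℕ))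
    (coins : List Bool) : List (List ℕ × ℕ) :=
  let t := tFlat q L n coins
  let rest := coins.drop (n * L)
  let C₁ := sampleWidth n Pr w R P PG
  List.zipWith (fun x ch => kernelFlat θ s N Pr w R q Q κh b P PG t x.1 x.2 ch) S
    ((List.range S.length).map fun i => (rest.drop (i * C₁)).take C₁)

/-- **A block of `m` machine-"uniform" reference samples**: sample `i` is `n + 1` residues mod `q` of `L`-bit blocks of the `i`-th
chunk of width `(n+1)L`. [cite: BrakerskiEtAl2013, Lemma 2.15 (proof sketch: self-generated uniform samples); RegevLWE2009, Lemma 4.1 (proof)] -/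
def refFlat (q L n m : ℕ) (coins : List Bool) : List (List ℕ × ℕ) :=
  (List.range m).map fun i =>
    (tFlat q L n ((coins.drop (i * ((n + 1) * L))).take ((n + 1) * L)),
      bitsToNat (((coins.drop (i * ((n + 1) * L))).take ((n + 1) * L)).drop (n * L) |>.take L) % q)

/-! ### Records and programs -/

/-- **The row record**: the kernel's record with the residue width `L` and the dimension `n` (unary). [folklore] -/
abbrev RRec : Type := KRec × (ℕ × ℕ)

/-- Its code. [folklore] -/
abbrev rRecE : RRec → List Bool := pairE kRecE (pairE unE unE)

/-- The genuine row record. [folklore] -/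
def rRecOf (θ : ℚ) (s N Pr w R q Q : ℕ) (κh : ℚ) (b P : ℕ) (PG : PGParams) (L n : ℕ) : RRec :=
  (kRecOf θ s N Pr w R q Q κh b P PG, (L, n))

/-- The row input `(S, coins)` and its code. [folklore] -/
abbrev rInE : List (List ℕ × ℕ) × List Bool → List Bool := pairE (rawE (pairE (rawE natE) natE)) strE

/-- **The shift against the record** (`q = r.1.2.1.1`, `L = r.2.1`, `n = r.2.2`). [cite: RegevLWE2009, Lemma 4.1 (proof)] -/
def tOf (r : RRec) (coins : List Bool) : List ℕ :=
  ((List.range r.2.2).map fun j => (coins.drop (j * r.2.1)).take r.2.1).map fun ch => bitsToNat ch % r.1.2.1.1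

/-- The sample width against the record: `n·width + P + coinLen`. [folklore] -/
def sampleWidthOf (r : RRec) : ℕ := r.2.2 * width r.1 + (r.1.2.2.1.2.2 + r.1.2.2.2.2)

/-- **The row against the record.** [cite: BrakerskiEtAl2013, Cor. 3.2 with Lemma 2.15] -/
def rowOf (r : RRec) (x : List (List ℕ × ℕ) × List Bool) : List (List ℕ × ℕ) :=
  let t := tOf r x.2
  let rest := x.2.drop (min (r.2.2 * r.2.1) x.2.length)
  let C₁ := sampleWidthOf r
  List.zipWith (fun y ch => kernelOf r.1 (t, (y, ch))) x.1 ((List.range x.1.length).map fun i => (rest.drop (i * C₁)).take C₁)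

/-- At the genuine record the shift program is `tFlat`. [folklore] -/
theorem tOf_rRecOf (θ : ℚ) (s N Pr w R q Q : ℕ) (κh : ℚ) (b P : ℕ) (PG : PGParams) (L n : ℕ) (coins : List Bool) :
    tOf (rRecOf θ s N Pr w R q Q κh b P PG L n) coins = tFlat q L n coins := by
  simp [tOf, tFlat, rRecOf, kRecOf, List.map_map, Function.comp_def]

/-- **At the genuine record the row program is `rowFlat`.** [folklore] -/
theorem rowOf_rRecOf (θ : ℚ) (s N Pr w R q Q : ℕ) (κh : ℚ) (b P : ℕ) (PG : PGParams) (L n : ℕ) (S : List (List ℕ × ℕ))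
    (coins : List Bool) :
    rowOf (rRecOf θ s N Pr w R q Q κh b P PG L n) (S, coins) = rowFlat θ s N Pr w R q Q κh b P PG L n S coins := by
  have hW : sampleWidthOf (rRecOf θ s N Pr w R q Q κh b P PG L n) = sampleWidth n Pr w R P PG := rfl
  have hK : (rRecOf θ s N Pr w R q Q κh b P PG L n).1 = kRecOf θ s N Pr w R q Q κh b P PG := rfl
  have hn : (rRecOf θ s N Pr w R q Q κh b P PG L n).2.2 = n := rfl
  have hL : (rRecOf θ s N Pr w R q Q κh b P PG L n).2.1 = L := rfl
  have hker : ∀ (t : List ℕ) (y : List ℕ × ℕ) (c : List Bool),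
      kernelOf (kRecOf θ s N Pr w R q Q κh b P PG) (t, (y, c)) = kernelFlat θ s N Pr w R q Q κh b P PG t y.1 y.2 c :=
    fun t y c => kernelOf_kRecOf θ s N Pr w R q Q κh b P PG t y.1 y.2 c
  unfold rowOf rowFlat
  simp only [hW, hK, hn, hL, tOf_rRecOf, hker, drop_min_length]

/-- **The reference record** `(q, (L, n, m))` (binary `q`, unary widths/counts) and its code. [folklore] -/
abbrev FRec : Type := ℕ × (ℕ × ℕ × ℕ)

/-- Its code. [folklore] -/
abbrev fRecE : FRec → List Bool := pairE natE (pairE unE (pairE unE unE))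

/-- **The reference block against the record.** [cite: BrakerskiEtAl2013, Lemma 2.15 (proof sketch)] -/
def refOf (r : FRec) (coins : List Bool) : List (List ℕ × ℕ) :=
  ((List.range r.2.2.2).map fun i => (coins.drop (i * ((r.2.2.1 + 1) * r.2.1))).take ((r.2.2.1 + 1) * r.2.1)).map fun ci =>
    ((((List.range r.2.2.1).map fun j => (ci.drop (j * r.2.1)).take r.2.1).map fun ch => bitsToNat ch % r.1),
      bitsToNat ((ci.drop (r.2.2.1 * r.2.1)).take r.2.1) % r.1)

/-- The reference program is `refFlat`. [folklore] -/
theorem refOf_eq (q L n m : ℕ) (coins : List Bool) : refOf (q, (L, n, m)) coins = refFlat q L n m coins := by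
  simp [refOf, refFlat, tFlat, List.map_map, Function.comp_def]

/-! ### Typed polynomial time -/

section CodeFP

/-- The shift is typed polynomial time in `(record, coins)`. [cite: AroraBarak2009, §1.3] -/
theorem tOf_codeFP : CodeFP (pairE rRecE strE) (rawE natE) (fun p => tOf p.1 p.2) := by
  have hr : CodeFP (pairE rRecE strE) rRecE (fun p => p.1) := fst _ _
  have hL : CodeFP (pairE rRecE strE) unE (fun p => p.1.2.1) := hr.snd'.fst'
  have hn : CodeFP (pairE rRecE strE) unE (fun p => p.1.2.2) := hr.snd'.snd'
  have hc : CodeFP (pairE rRecE strE) strE (fun p => p.2) := snd _ _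
  have hchunks : CodeFP (pairE rRecE strE) (rawE strE) (fun p => (List.range p.1.2.2).map fun j => (p.2.drop (j * p.1.2.1)).take p.1.2.1) :=
    (strChunks.comp (hn.pair (hL.pair hc)) :)
  have hstep : CodeFP (pairE rRecE strE) natE (fun p => bitsToNat p.2 % p.1.1.2.1.1) :=
    (natMod.comp ((strVal.comp (snd _ _)).pair (fst _ _).fst'.snd'.fst'.fst') :)
  exact (((map hstep).comp (hr.pair hchunks)).congr fun p => rfl)

/-- The sample width against the record is typed polynomial time (unary). [folklore] -/
theorem sampleWidthOf_codeFP : CodeFP rRecE unE sampleWidthOf := by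
  have hk : CodeFP rRecE kRecE (fun r => r.1) := fst _ _
  have hn : CodeFP rRecE unE (fun r => r.2.2) := (snd _ _).snd'
  have hw : CodeFP rRecE unE (fun r => r.1.1.2.1) := hk.fst'.snd'.fst'
  have hR : CodeFP rRecE unE (fun r => r.1.1.2.2) := hk.fst'.snd'.snd'
  have hPr : CodeFP rRecE unE (fun r => r.1.1.1.2.2.2.1) := hk.fst'.fst'.snd'.snd'.snd'.fst'
  have hP : CodeFP rRecE unE (fun r => r.1.2.2.1.2.2) := hk.snd'.snd'.fst'.snd'.snd'
  have hpgLen : CodeFP rRecE unE (fun r => r.1.2.2.2.2) := hk.snd'.snd'.snd'.snd'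
  have hC : CodeFP rRecE unE (fun r => width r.1) :=
    (unMul_codeFP.comp (hR.pair (unAdd.comp ((unSucc.comp hw).pair hPr)))).congr fun r => by simp [width]
  exact ((unAdd.comp ((unMul_codeFP.comp (hn.pair hC)).pair (unAdd.comp (hP.pair hpgLen)))).congr fun r => by simp [sampleWidthOf])

/-- **The row is typed polynomial time** in `(record, (S, coins))`. [cite: BrakerskiEtAl2013, §5; AroraBarak2009, §1.3] -/
theorem rowOf_codeFP : CodeFP (pairE rRecE rInE) (rawE (pairE (rawE natE) natE)) (fun p => rowOf p.1 p.2) := by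
  have hr : CodeFP (pairE rRecE rInE) rRecE (fun p => p.1) := fst _ _
  have hS : CodeFP (pairE rRecE rInE) (rawE (pairE (rawE natE) natE)) (fun p => p.2.1) := (snd _ _).fst'
  have hc : CodeFP (pairE rRecE rInE) strE (fun p => p.2.2) := (snd _ _).snd'
  have hL : CodeFP (pairE rRecE rInE) unE (fun p => p.1.2.1) := hr.snd'.fst'
  have hn : CodeFP (pairE rRecE rInE) unE (fun p => p.1.2.2) := hr.snd'.snd'
  -- the shift
  have ht : CodeFP (pairE rRecE rInE) (rawE natE) (fun p => tOf p.1 p.2.2) := (tOf_codeFP.comp (hr.pair hc) :)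
  -- the rest of the coins and its chunks
  have hoff : CodeFP (pairE rRecE rInE) unE (fun p => min (p.1.2.2 * p.1.2.1) p.2.2.length) :=
    (unOfNatMin.comp ((strLength.comp hc).pair (natMul.comp ((natOfUn.comp hn).pair (natOfUn.comp hL)))) :)
  have hrest : CodeFP (pairE rRecE rInE) strE (fun p => p.2.2.drop (min (p.1.2.2 * p.1.2.1) p.2.2.length)) :=
    (strDrop.comp (hoff.pair hc) :)
  have hm : CodeFP (pairE rRecE rInE) unE (fun p => p.2.1.length) := ((ulength _).comp hS :)
  have hC₁ : CodeFP (pairE rRecE rInE) unE (fun p => sampleWidthOf p.1) := (sampleWidthOf_codeFP.comp hr :)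
  have hchunks : CodeFP (pairE rRecE rInE) (rawE strE) (fun p => (List.range p.2.1.length).map fun i =>
      ((p.2.2.drop (min (p.1.2.2 * p.1.2.1) p.2.2.length)).drop (i * sampleWidthOf p.1)).take (sampleWidthOf p.1)) :=
    (strChunks.comp (hm.pair (hC₁.pair hrest)) :)
  -- the samples, with the context `(record, t)`
  have hstep : CodeFP (pairE (pairE rRecE (rawE natE)) (pairE (pairE (rawE natE) natE) strE)) (pairE (rawE natE) natE)
      (fun p => kernelOf p.1.1.1 (p.1.2, (p.2.1, p.2.2))) :=
    (kernelOf_codeFP.comp ((fst _ _).fst'.fst'.pair ((fst _ _).snd'.pair ((snd _ _).fst'.pair (snd _ _).snd'))) :)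
  have hz := (zipWith hstep).comp ((hr.pair ht).pair (hS.pair hchunks))
  exact hz.congr fun p => rfl

/-- **The reference block is typed polynomial time** in `(record, coins)`. [cite: AroraBarak2009, §1.3] -/
theorem refOf_codeFP : CodeFP (pairE fRecE strE) (rawE (pairE (rawE natE) natE)) (fun p => refOf p.1 p.2) := by
  have hr : CodeFP (pairE fRecE strE) fRecE (fun p => p.1) := fst _ _
  have hq : CodeFP (pairE fRecE strE) natE (fun p => p.1.1) := hr.fst'
  have hL : CodeFP (pairE fRecE strE) unE (fun p => p.1.2.1) := hr.snd'.fst'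
  have hn : CodeFP (pairE fRecE strE) unE (fun p => p.1.2.2.1) := hr.snd'.snd'.fst'
  have hm : CodeFP (pairE fRecE strE) unE (fun p => p.1.2.2.2) := hr.snd'.snd'.snd'
  have hc : CodeFP (pairE fRecE strE) strE (fun p => p.2) := snd _ _
  have hW : CodeFP (pairE fRecE strE) unE (fun p => (p.1.2.2.1 + 1) * p.1.2.1) := (unMul_codeFP.comp ((unSucc.comp hn).pair hL) :)
  have hchunks : CodeFP (pairE fRecE strE) (rawE strE) (fun p => (List.range p.1.2.2.2).map fun i =>
      (p.2.drop (i * ((p.1.2.2.1 + 1) * p.1.2.1))).take ((p.1.2.2.1 + 1) * p.1.2.1)) :=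
    (strChunks.comp (hm.pair (hW.pair hc)) :)
  -- one item from a chunk, with the record as context
  have hctx : CodeFP (pairE fRecE strE) fRecE (fun p => p.1) := fst _ _
  have hq' : CodeFP (pairE fRecE strE) natE (fun p => p.1.1) := hctx.fst'
  have hL' : CodeFP (pairE fRecE strE) unE (fun p => p.1.2.1) := hctx.snd'.fst'
  have hn' : CodeFP (pairE fRecE strE) unE (fun p => p.1.2.2.1) := hctx.snd'.snd'.fst'
  have hci : CodeFP (pairE fRecE strE) strE (fun p => p.2) := snd _ _
  have hsub : CodeFP (pairE fRecE strE) (rawE strE) (fun p => (List.range p.1.2.2.1).map fun j => (p.2.drop (j * p.1.2.1)).take p.1.2.1) :=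
    (strChunks.comp (hn'.pair (hL'.pair hci)) :)
  have hmodStep : CodeFP (pairE fRecE strE) natE (fun p => bitsToNat p.2 % p.1.1) := (natMod.comp ((strVal.comp hci).pair hq') :)
  have ha : CodeFP (pairE fRecE strE) (rawE natE)
      (fun p => ((List.range p.1.2.2.1).map fun j => (p.2.drop (j * p.1.2.1)).take p.1.2.1).map fun ch => bitsToNat ch % p.1.1) :=
    (((map hmodStep).comp (hctx.pair hsub)).congr fun p => rfl)
  have hb : CodeFP (pairE fRecE strE) natE (fun p => bitsToNat ((p.2.drop (p.1.2.2.1 * p.1.2.1)).take p.1.2.1) % p.1.1) :=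
    (natMod.comp ((strVal.comp (strTake.comp (hL'.pair (strDrop.comp ((unMul_codeFP.comp (hn'.pair hL')).pair hci))))).pair hq') :)
  have hitem := ha.pair hb
  exact (((map hitem).comp (hr.pair hchunks)).congr fun p => rfl)

end CodeFP

end KProg

end BLPRS2013

end Literature.Computability.Cryptography

end
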